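import Summits.AnomalousDissipation.AnomalousDissipation.Theses.MomentParity

/-!
# Sketch — crux-ideate stmt-AnomalousDissipation-14331 (`MomentParity.QuarticTightness`), round 1, ideator 2

First lemmas of the idea card `saddle-saturation` (Cruxes/QuarticTightness/Ideas/saddle-saturation.md),
typed over existing declarations. Nothing here is proposed to the gate; `sorry` only inside the two
registered first lemmas. The composition `quarticTightness_of_universalPOZL` is sorry-free GIVEN the
first lemma, and shows the line concludes the crux BY NAME.

Vocabulary = the verbatim clauses of `QuarticTightness` (same names as
`Cruxes/QuarticGate/Disproof.lean`: `IsLevel / IsBandTest / polyGrad / IsPolyStationary`).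
-/

namespace Summit.AnomalousDissipation.AnomalousDissipation.Cruxes.QuarticTightness.Ideate2

open MeasureTheory Filter Topology
open scoped ENNReal
open Literature.Analysis.FunctionSpaces Literature.Analysis.FluidPDE
open Summit.AnomalousDissipation.AnomalousDissipation.Theses.MomentParity

noncomputable section

/-- Level-`N` carried field (verbatim clause). -/
def IsLevel (N : ℕ) (u : Torus.energySpace (Fin 3)) : Prop :=
  ∀ k ∉ (Torus.freqBall N).erase (0 : Fin 3 → ℤ),
    UnitAddTorus.mFourierCoeff (EuclideanSpace.complexify ∘
      (u.1 : UnitAddTorus (Fin 3) → EuclideanSpace ℝ (Fin 3))) k = 0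

/-- Band-limited smooth solenoidal mean-zero test field (verbatim clause). -/
def IsBandTest (N : ℕ) (g : UnitAddTorus (Fin 3) → EuclideanSpace ℝ (Fin 3)) : Prop :=
  Torus.IsSmooth g ∧ Torus.IsDivFree g ∧ Torus.HasZeroMean g ∧
    ∀ k ∉ (Torus.freqBall N).erase (0 : Fin 3 → ℤ),
      UnitAddTorus.mFourierCoeff (EuclideanSpace.complexify ∘ g) k = 0

/-- `∇p(u) = Σᵢ ∂ᵢP((u,g₁),…,(u,gₘ)) gᵢ` (verbatim test-field expression). -/
def polyGrad {m : ℕ} (g : Fin m → UnitAddTorus (Fin 3) → EuclideanSpace ℝ (Fin 3))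
    (P : MvPolynomial (Fin m) ℝ) (u : Torus.energySpace (Fin 3)) :
    UnitAddTorus (Fin 3) → EuclideanSpace ℝ (Fin 3) :=
  fun x => ∑ i : Fin m,
    (MvPolynomial.eval (fun j => Torus.pairing u.1 (g j)) (MvPolynomial.pderiv i P)) • g i x

/-- `d`-stationarity at `(ν, f, N)` (verbatim rows). -/
def IsPolyStationary (ν : ℝ) (f : UnitAddTorus (Fin 3) → EuclideanSpace ℝ (Fin 3)) (N d : ℕ)
    (μ : Measure (Torus.energySpace (Fin 3))) : Prop :=
  ∀ (m : ℕ) (g : Fin m → UnitAddTorus (Fin 3) → EuclideanSpace ℝ (Fin 3))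
    (P : MvPolynomial (Fin m) ℝ), (∀ i, IsBandTest N (g i)) → P.totalDegree + 1 ≤ d →
    Integrable (fun u => Torus.nsGeneratorPairing ν f u (polyGrad g P u)) μ ∧
      ∫ u, Torus.nsGeneratorPairing ν f u (polyGrad g P u) ∂μ = 0

/-- The HYPOTHESIS of `QuarticTightness` at `(f, ν, E, ε)` (= the body of `QuarticGate`). -/
def QuarticHyp (f : UnitAddTorus (Fin 3) → EuclideanSpace ℝ (Fin 3)) (ν : ℕ → ℝ) (E ε : ℝ) : Prop :=
  ∀ j : ℕ, ∃ᶠ N in atTop, ∃ μ : Measure (Torus.energySpace (Fin 3)),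
    IsProbabilityMeasure μ ∧ (∀ᵐ u ∂μ, IsLevel N u) ∧
    Integrable (fun u : Torus.energySpace (Fin 3) => ‖u‖ ^ 4) μ ∧
    IsPolyStationary (ν j) f N 4 μ ∧ Torus.ensembleEnergy μ ≤ E ∧ ε ≤ Torus.ensembleDissipation (ν j) μ

/-- The CONCLUSION of `QuarticTightness` at `(f, ν)` (verbatim: loud ladder witnesses with bounded
support at every order, `N`-frequently, budgets uniform in `j`). -/
def LadderConclusion (f : UnitAddTorus (Fin 3) → EuclideanSpace ℝ (Fin 3)) (ν : ℕ → ℝ) : Prop :=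
  ∃ E' ε' : ℝ, 0 < ε' ∧ ∀ j : ℕ, ∃ R : ℝ, ∃ᶠ N in atTop, ∀ d : ℕ,
    ∃ μ : Measure (Torus.energySpace (Fin 3)), IsProbabilityMeasure μ ∧
      (∀ᵐ u ∂μ, IsLevel N u) ∧ (∀ᵐ u ∂μ, ‖u‖ ≤ R) ∧ IsPolyStationary (ν j) f N d μ ∧
      Torus.ensembleEnergy μ ≤ E' ∧ ε' ≤ Torus.ensembleDissipation (ν j) μ

/-- `QuarticTightness` restated through the vocabulary (definitional unfolding). -/
theorem quarticTightness_iff :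
    QuarticTightness ↔ ∀ f : UnitAddTorus (Fin 3) → EuclideanSpace ℝ (Fin 3),
      Torus.IsSmooth f → Torus.IsDivFree f → Torus.HasZeroMean f →
      ∀ (ν : ℕ → ℝ) (E ε : ℝ), (∀ j, 0 < ν j) → Tendsto ν atTop (𝓝 0) → 0 < ε →
      QuarticHyp f ν E ε → LadderConclusion f ν :=
  Iff.rfl

/-! ## The lever's objects: Galerkin trajectories in coefficient form, cycle (occupation) measures -/

/-- A level-`N` GALERKIN TRAJECTORY of NS at `(ν, f)` in weak/coefficient form: `γ` is continuous,
level-`N` valued, and every band-limited pairing `t ↦ (γ t, g)` is differentiable with derivative the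
generator pairing `⟨F_ν(γ t), g⟩ = (f,g) + ν(γ t, Δg) + ∫ γ t ⊗ γ t : ∇g`. Against level-`N` tests on
level-`N` fields this IS the Fourier–Galerkin ODE of the tree (`CylindricalGenerator`,
`NSGalerkinFourier`), written without choosing coordinates. -/
def IsGalerkinTrajectory (ν : ℝ) (f : UnitAddTorus (Fin 3) → EuclideanSpace ℝ (Fin 3)) (N : ℕ)
    (γ : ℝ → Torus.energySpace (Fin 3)) : Prop :=
  Continuous γ ∧ (∀ t, IsLevel N (γ t)) ∧
    ∀ g, IsBandTest N g → ∀ t : ℝ,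
      HasDerivAt (fun s => Torus.pairing (γ s).1 g) (Torus.nsGeneratorPairing ν f (γ t) g) t

/-- The CYCLE MEASURE (occupation measure over one period) of a trajectory:
`μ_γ = T⁻¹ ∫₀ᵀ δ_{γ t} dt`, i.e. the push-forward of normalised Lebesgue measure on `(0, T]`. -/
def cycleMeasure (T : ℝ) (γ : ℝ → Torus.energySpace (Fin 3)) : Measure (Torus.energySpace (Fin 3)) :=
  (ENNReal.ofReal T)⁻¹ • Measure.map γ (volume.restrict (Set.Ioc 0 T))

/-- PERIODIC-ORBIT ZEROTH LAW for the force `f` along `ν` (the card's `C⁺` at one force): budgets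
`E', ε' > 0` uniform in `j`; at each `j` a radius `R` and, for infinitely many levels `N`, a
`T`-periodic level-`N` Galerkin trajectory inside `‖u‖ ≤ R` whose time-averaged energy is `≤ E'` and
time-averaged dissipation `ν_j‖∇u‖²` is `≥ ε'`. Steady states are the case "every `T`". -/
def PeriodicOrbitZerothLaw (f : UnitAddTorus (Fin 3) → EuclideanSpace ℝ (Fin 3)) (ν : ℕ → ℝ) : Prop :=
  ∃ E' ε' : ℝ, 0 < ε' ∧ ∀ j : ℕ, ∃ R : ℝ, ∃ᶠ N in atTop, ∃ T : ℝ, 0 < T ∧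
    ∃ γ : ℝ → Torus.energySpace (Fin 3), IsGalerkinTrajectory (ν j) f N γ ∧
      (∀ t, γ (t + T) = γ t) ∧ (∀ t, ‖γ t‖ ≤ R) ∧
      T⁻¹ * (∫ t in Set.Ioc 0 T, ‖γ t‖ ^ 2) ≤ E' ∧
      ε' ≤ T⁻¹ * ∫ t in Set.Ioc 0 T,
        ν j * (Torus.eGradNormSq ((γ t).1 : UnitAddTorus (Fin 3) → EuclideanSpace ℝ (Fin 3))).toReal

/-- **FIRST LEMMA (card `saddle-saturation`)** — cycle measures are ladder witnesses at EVERY order.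
For a `T`-periodic level-`N` Galerkin trajectory `γ` inside `‖u‖ ≤ R`, `μ_γ` is a probability measure,
level-`N` and `B_R` carried, its energy/dissipation are the time averages, and for every polynomial
cylindrical band-limited observable `p` (any degree) the row vanishes:
`∫ ⟨F, ∇p⟩ dμ_γ = T⁻¹ ∫₀ᵀ (d/dt) p(γ t) dt = T⁻¹ (p(γ T) − p(γ 0)) = 0` (chain rule through the
finitely many pairings `(γ t, gᵢ)` + periodicity). Hence `PeriodicOrbitZerothLaw f ν` gives the
conclusion of the crux at `(f, ν)` with the same `E', ε', R` and the same levels. Size M (measure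
transport `ℝ → H`, `MvPolynomial` chain rule, continuity of the row integrand on level-`N` fields from
`continuous_nsGeneratorPairing`, `lintegral_map` for `eGradNormSq`). -/
theorem ladderConclusion_of_periodicOrbitZerothLaw
    (f : UnitAddTorus (Fin 3) → EuclideanSpace ℝ (Fin 3)) (hf : Torus.IsSmooth f)
    (ν : ℕ → ℝ) (hν : ∀ j, 0 < ν j) :
    PeriodicOrbitZerothLaw f ν → LadderConclusion f ν := by
  sorry

/-- **FIRST LEMMA, steady special case** (the smallest honest instance, already M-sized): the Dirac mass
at a level-`N` STEADY Galerkin state `u⋆` (`⟨F_ν(u⋆), g⟩ = 0` for every band-limited test `g`) is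
`d`-stationary for every `d`, with energy `‖u⋆‖²` and dissipation `ν‖∇u⋆‖²`; cf. the sibling's
`isPolyStationary_dirac_kolState` (laminar case) in `Cruxes/QuarticGate/Disproof.lean`. -/
theorem isPolyStationary_dirac_of_steady (ν : ℝ) (f : UnitAddTorus (Fin 3) → EuclideanSpace ℝ (Fin 3))
    (hf : Torus.IsSmooth f) (N d : ℕ) (u : Torus.energySpace (Fin 3)) (hu : IsLevel N u)
    (hsteady : ∀ g, IsBandTest N g → Torus.nsGeneratorPairing ν f u g = 0) :
    IsPolyStationary ν f N d (Measure.dirac u) := by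
  sorry

/-- **COMPOSITION** (sorry-free given the first lemma): the crux BY NAME from the universal
periodic-orbit zeroth law on forces satisfying the typed hypothesis ("designable" forces). This is the
exact shape a crux-plan skeleton `QuarticTightness_of` would have; the load-bearing stub is `hPOZL`. -/
theorem quarticTightness_of_universalPOZL
    (hPOZL : ∀ f : UnitAddTorus (Fin 3) → EuclideanSpace ℝ (Fin 3),
      Torus.IsSmooth f → Torus.IsDivFree f → Torus.HasZeroMean f →
      ∀ ν : ℕ → ℝ, (∀ j, 0 < ν j) → Tendsto ν atTop (𝓝 0) →
      (∃ E ε : ℝ, 0 < ε ∧ QuarticHyp f ν E ε) → PeriodicOrbitZerothLaw f ν) :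
    QuarticTightness := by
  rw [quarticTightness_iff]
  intro f hfs hfd hfz ν E ε hν hν0 hε hyp
  exact ladderConclusion_of_periodicOrbitZerothLaw f hfs ν hν
    (hPOZL f hfs hfd hfz ν hν hν0 ⟨E, ε, hε, hyp⟩)

end

end Summit.AnomalousDissipation.AnomalousDissipation.Cruxes.QuarticTightness.Ideate2
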